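import Summits.CriticalPhenomena.PercolationContinuityZ3.Theorems.PercNearOneGluingNoHeavyQuantSliceMidsBelowBudget
import Summits.CriticalPhenomena.PercolationContinuityZ3.Theorems.PercNearOneGluingNoHeavyQuantSliceShallowZero
import HarnessLib

/-!
# QUANT lane R8, T-DEC: SL-λ* for EVERY support at `g ≥ 1/2`, modulo the local BAND PIECE (Theorem E, part 1) — the columns `h ≤ λ` of the
# corner witness and the pool budget of the rest (LEAD-NOTES-G23 N52)

builds on p205010 (kernel theorem, internal audit signed; external expert review pending)

Support file (`--supports stmt-CriticalPhenomena-4575`), QUANT lane lead seat prim-quant-lead (gen 23), rung R8 of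
`run/shared/lean/prim/quant/LADDER.md`.  Three small definitions (`lamFlow`, `lamResidual`, `lamResidualFlow`) and theorems; standard
axioms, no sorries.  Same architecture as Theorem D part 1 (`…QuantSliceLowsBelowBudget`) with the `M_b` columns `h + a ≤ j′` replaced by
ALL columns `h ≤ λ` (`M_b ⊆ {h ≤ λ}` since `j′ ≤ λ + a`), which removes Theorem D's side condition on giant-copy atoms.

THEOREM E (`…QuantSliceLamColumns`): probability law `ν`, `0 < x < 1`, `1 ≤ a ≤ j′`, `x ≤ g ≤ 1`, `1/2 ≤ g`, `λ ≤ j′ ≤ λ + a`; SUPPORT: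
every charged non-low `k ≤ λ` is band-like at `T′ = T + ag` or has `k + a ≤ j′`, every charged atom in `(λ, j′]` is a true mid at `T′`
(both automatic for `λ = λ*`); HYPOTHESIS (the BAND PIECE, census-1 g19 / typer g24 `LawDec.BandTwoBlobDEC`): every charged CHEAP band
pair `{l, h; pairGate}` of the law (`l < h ≤ λ`, `2l < T < l + h`, `2h ≤ T′`, `j′ < h + a`, `pairGate x T l h < x`) slices to a `DECAtT`
law at `(T′, j′)`.  THEN `DEC(T,j′) ∧ DEC(T,λ) ⟹ slice DEC(T′, j′)`.
HERE: `lamFlow` and its elementary facts, the corner identity in the form **`residual_low_eq_leftover_lam`** (the residual mass of every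
low `l ≤ λ` IS the `λ`-run's giant-bound mass, unconditionally), and **`pool_budget_lamColumns`** (Theorem D's budget without `hcopy`).

[this work]; nothing here is cited as a published result.  The gluing rows served [cite: KozmaNitzan2024, Conjecture 3 (p. 15)]; product
measure [cite: Grimmett1999, §1.3 p. 10].
-/

noncomputable section

namespace Summit.CriticalPhenomena.PercolationContinuityZ3.Theorems

namespace Quant

open Finset

namespace LawDec

/-! ### Theorem E: all columns `≤ λ` removed (LEAD-NOTES-G23 N52) -/

section LamColumns

variable (x T g : ℝ) (j' M a lam : ℕ) (ν : ℕ → ℝ)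

/-- **the columns `h ≤ λ` of the corner witness at `j′`** — by the corner identity (`cornerMidFlow_restrict`) these coincide with the columns
`h ≤ λ` of the corner run at `λ`. [this work] -/
def lamFlow (x T : ℝ) (j' M lam : ℕ) (ν : ℕ → ℝ) : ℕ → ℕ → ℝ := fun l h =>
  if h ≤ lam then cornerMidFlow x T j' M ν l h else 0

/-- `0 ≤ lamFlow ≤ cornerWitness` (`λ ≤ j′`). -/
theorem lamFlow_nonneg_le (hx0 : 0 < x) (hx1 : x < 1) (hν : ∀ k, 0 ≤ ν k)
    (hC : CornerSucceeds x T j' M ν) (hlamj : lam ≤ j') (l h : ℕ) :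
    0 ≤ lamFlow x T j' M lam ν l h ∧ lamFlow x T j' M lam ν l h ≤ cornerWitness x T j' M ν l h := by
  obtain ⟨h0, -, -, -⟩ := cornerFlow_inv x T j' M ν hx0 hx1 hν ((j' + 1) * (j' + 1)) le_rfl
  have hW := (isFlowAtT_cornerWitness x T j' M ν hx0 hx1 hν hC).1 l h
  unfold lamFlow
  split_ifs with hc
  · rw [cornerWitness_of_le x T j' M ν l h (by omega)]
    exact ⟨h0 l h, le_rfl⟩
  · exact ⟨le_rfl, hW⟩

/-- a charged pair of `lamFlow`: the column is `≤ λ`, charged and compatible with its (charged) low. -/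
theorem lamFlow_pos (hx0 : 0 < x) (hx1 : x < 1) (hν : ∀ k, 0 ≤ ν k) (l h : ℕ) (hp : 0 < lamFlow x T j' M lam ν l h) :
    h ≤ lam ∧ l ≤ j' ∧ 2 * (l : ℝ) < T ∧ h ≤ M ∧ T < (l : ℝ) + h ∧ 0 < ν h := by
  obtain ⟨h0, hsup, -, hcol⟩ := cornerFlow_inv x T j' M ν hx0 hx1 hν ((j' + 1) * (j' + 1)) le_rfl
  unfold lamFlow at hp
  split_ifs at hp with hc
  · obtain ⟨hl, hhj, hlow, hhM, hcomp, -⟩ := hsup l h hp.ne'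
    have hlh : l < h := by
      have : (l : ℝ) < h := by linarith
      exact_mod_cast this
    have hu := usage_pos_of_compat x T j' l h hx0 hx1 hlow hlh (Or.inr hcomp)
    have hterm : usage x T j' l h * cornerMidFlow x T j' M ν l h
        ≤ ∑ l' ∈ Finset.range (j' + 1), usage x T j' l' h * cornerMidFlow x T j' M ν l' h := by
      refine Finset.single_le_sum (f := fun l' => usage x T j' l' h * cornerMidFlow x T j' M ν l' h)
        (fun l' _ => ?_) (Finset.mem_range.2 (by omega))
      show 0 ≤ usage x T j' l' h * cornerMidFlow x T j' M ν l' h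
      rcases (h0 l' h).eq_or_lt with hz | hp'
      · unfold cornerMidFlow; rw [← hz, mul_zero]
      · obtain ⟨-, -, hlow', -, hcomp', -⟩ := hsup l' h hp'.ne'
        have hl'h : l' < h := by
          have : (l' : ℝ) < h := by linarith
          exact_mod_cast this
        exact (mul_pos (usage_pos_of_compat x T j' l' h hx0 hx1 hlow' hl'h (Or.inr hcomp')) hp').le
    exact ⟨hc, hl, hlow, hhM, hcomp, lt_of_lt_of_le (lt_of_lt_of_le (mul_pos hu hp) hterm) (hcol h)⟩
  · exact absurd hp (lt_irrefl _)

/-- **the residual low mass is the λ-run's giant-bound mass** (no side condition): for `l ≤ λ`,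
`ν l − Σ_h lamFlow l h = cornerLeftover x T λ M ν l` (corner identity `cornerLeftover_restrict`). [this work] -/
theorem residual_low_eq_leftover_lam (hx0 : 0 < x) (hx1 : x < 1) (hν : ∀ k, 0 ≤ ν k) (hlamj : lam ≤ j')
    (l : ℕ) (hl : l ≤ lam) :
    ν l - ∑ h ∈ Finset.range (M + 1), lamFlow x T j' M lam ν l h = cornerLeftover x T lam M ν l := by
  rw [cornerLeftover_restrict x T j' M ν lam hx0 hx1 hν hlamj l hl]
  unfold cornerLeftover
  have e : ∀ h ∈ Finset.range (M + 1), lamFlow x T j' M lam ν l h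
      = cornerMidFlow x T j' M ν l h - (if lam < h then cornerMidFlow x T j' M ν l h else 0) := by
    intro h _
    unfold lamFlow
    by_cases hb : h ≤ lam
    · rw [if_pos hb, if_neg (show ¬ (lam < h) by omega)]; ring
    · rw [if_neg hb, if_pos (show lam < h by omega)]; ring
  rw [Finset.sum_congr rfl e, Finset.sum_sub_distrib]
  ring

/-- **the residual law of Theorem E**: `ν` minus the law carried by the columns `h ≤ λ` of the corner witness. [this work] -/
def lamResidual (x T : ℝ) (j' M lam : ℕ) (ν : ℕ → ℝ) : ℕ → ℝ :=
  fun k => ν k - subflowLaw x T j' M (lamFlow x T j' M lam ν) k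

/-- **the residual flow of Theorem E**: the corner witness minus its columns `h ≤ λ`. [this work] -/
def lamResidualFlow (x T : ℝ) (j' M lam : ℕ) (ν : ℕ → ℝ) : ℕ → ℕ → ℝ :=
  fun l h => cornerWitness x T j' M ν l h - lamFlow x T j' M lam ν l h

/-- **THE POOL BUDGET OF THEOREM E**: the residual law (corner witness minus ALL its columns `h ≤ λ`) with its shallow / far-deep lows zeroed,
plus their row-0 copies, fit into the pool — `g·CornerSucceeds(λ) + (1−g)·(H_j′ restricted)`, corner identity, `g ≥ 1/2`; no side condition
on the columns. [this work] -/
theorem pool_budget_lamColumns (hx0 : 0 < x) (hx1 : x < 1) (hg0 : 0 ≤ g) (hg1 : g ≤ 1) (hg2 : 1 / 2 ≤ g)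
    (hν : ∀ k, 0 ≤ ν k) (hνM : ∀ k, M < k → ν k = 0) (hlamj : lam ≤ j')
    (hCj : CornerSucceeds x T j' M ν) (hCl : CornerSucceeds x T lam M ν)
    (hlows : ∀ k, k ≤ j' → 2 * (k : ℝ) < T → ν k ≠ 0 →
      (2 * ((k : ℝ) + a) < T + (a : ℝ) * g ∧ k + a ≤ j') ∨ ((T + (a : ℝ) * g ≤ 2 * ((k : ℝ) + a) ∨ j' < k + a) ∧ k ≤ lam))
    (habove : ∀ k, lam < k → k ≤ j' → ν k ≠ 0 → T + (a : ℝ) * g < 2 * (k : ℝ)) :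
    x / (1 - x) * (∑ l ∈ Finset.range (j' + 1), (if 2 * (l : ℝ) < T then
        dlRest x T g j' a (zeroShallow T g j' lam a (lamResidual x T j' M lam ν)) (zeroShallowFlow T g j' lam a (lamResidualFlow x T j' M lam ν)) l
        else 0)
      + (1 - g) * ∑ l ∈ Finset.range (j' + 1),
        (if l ≤ lam ∧ 2 * (l : ℝ) < T ∧ (T + (a : ℝ) * g ≤ 2 * ((l : ℝ) + a) ∨ j' < l + a) then lamResidual x T j' M lam ν l else 0))
      ≤ dlPoolTot g j' M lam (zeroShallow T g j' lam a (lamResidual x T j' M lam ν)) := by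
  set fB := lamFlow x T j' M lam ν with hfB
  have eνR : lamResidual x T j' M lam ν = fun k => ν k - subflowLaw x T j' M fB k := rfl
  have efR : lamResidualFlow x T j' M lam ν = fun l h => cornerWitness x T j' M ν l h - fB l h := rfl
  rw [eνR, efR]
  set νR : ℕ → ℝ := fun k => ν k - subflowLaw x T j' M fB k with hνR
  set fR : ℕ → ℕ → ℝ := fun l h => cornerWitness x T j' M ν l h - fB l h with hfR
  have hu : 0 < x / (1 - x) := div_pos hx0 (by linarith)
  obtain ⟨hV0, hsup, hrow, hcol⟩ := cornerFlow_inv x T j' M ν hx0 hx1 hν ((j' + 1) * (j' + 1)) le_rfl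
  have hW := isFlowAtT_cornerWitness x T j' M ν hx0 hx1 hν hCj
  have hB0 : ∀ l h, 0 ≤ fB l h := fun l h => (lamFlow_nonneg_le x T j' M lam ν hx0 hx1 hν hCj hlamj l h).1
  have hBle : ∀ l h, fB l h ≤ cornerWitness x T j' M ν l h :=
    fun l h => (lamFlow_nonneg_le x T j' M lam ν hx0 hx1 hν hCj hlamj l h).2
  have hR : IsFlowAtT x T j' M νR fR := isFlowAtT_residual_of_subflow x T j' M ν _ fB hx0 hx1 hW hB0 hBle
  have hνR0 : ∀ k, 0 ≤ νR k := residual_nonneg_of_subflow x T j' M ν _ fB hx0 hx1 hνM hW hB0 hBle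
  have hνRle : ∀ k, νR k ≤ ν k := fun k => by
    show ν k - subflowLaw x T j' M fB k ≤ ν k
    linarith [subflowLaw_nonneg x T j' M ν _ fB hx0 hx1 hW hB0 hBle k]
  have hneR : ∀ k, νR k ≠ 0 → ν k ≠ 0 := fun k hk hz => hk (le_antisymm (by linarith [hνRle k]) (hνR0 k))
  -- the residual with its shallow lows zeroed
  set νD := zeroShallow T g j' lam a νR with hνDdef
  set fD := zeroShallowFlow T g j' lam a fR with hfDdef
  have hRD : IsFlowAtT x T j' M νD fD := isFlowAtT_zeroShallow x T g j' M a lam νR j' fR hx0 hx1 hlamj hR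
  have hνD0 : ∀ k, 0 ≤ νD k := zeroShallow_nonneg T g j' a lam νR hνR0
  have hdeepD : ∀ k, k ≤ j' → 2 * (k : ℝ) < T → νD k ≠ 0 → 2 * ((k : ℝ) + a) < T + (a : ℝ) * g ∧ k + a ≤ j' := by
    intro k hk hlow hne
    have hne' := hneR k (ne_zero_of_zeroShallow_ne_zero T g j' a lam νR k hne)
    rcases hlows k hk hlow hne' with hd | ⟨hs, hkl⟩
    · exact hd
    · exfalso; apply hne; simp only [hνDdef]; unfold zeroShallow; rw [if_pos ⟨hkl, hlow, hs⟩]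
  -- (C) the key step for the zeroed residual datum
  have hC : (1 - g) * ∑ l ∈ Finset.range (j' + 1), (if 2 * (l : ℝ) < T then ∑ m ∈ Finset.range (j' + 1), fD l m else 0)
      ≤ ∑ l ∈ Finset.range (j' + 1), (if 2 * (l : ℝ) < T then ∑ m ∈ Finset.range (j' + 1), dlAd x T g j' a νD fD l m else 0) := by
    rw [Finset.mul_sum]
    refine Finset.sum_le_sum fun l hl => ?_
    have hl' : l ≤ j' := Nat.lt_succ_iff.1 (Finset.mem_range.1 hl)
    split_ifs with hlow
    · exact sum_dlAd_ge x T g j' M a νD fD hx0 hx1 hg1 hg2 hνD0 hRD hdeepD l hl' hlow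
    · simp
  -- (B) (H_j′) in pool form for the zeroed residual datum
  have hB := pool_of_flow_top x T j' M νD fD hx0 hx1 hRD
  -- (A) (H_λ) through the corner identity: u·Σ ν_R(lows) ≤ ν(>λ) = ν_R(>λ)
  have hνRlow : ∀ l, l ≤ j' → 2 * (l : ℝ) < T → νR l = cornerLeftover x T lam M ν l := by
    intro l hl hlow
    have hcol0 : ∑ l' ∈ Finset.range (j' + 1), usage x T j' l' l * fB l' l = 0 :=
      subflow_col_low x T j' M ν _ fB hx0 hx1 hW hB0 hBle l hl hlow
    show ν l - subflowLaw x T j' M fB l = cornerLeftover x T lam M ν l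
    unfold subflowLaw
    rw [hcol0, add_zero]
    by_cases hllam : l ≤ lam
    · exact residual_low_eq_leftover_lam x T j' M lam ν hx0 hx1 hν hlamj l hllam
    · -- lows above λ are uncharged: both sides vanish
      have hz : ν l = 0 := by
        by_contra hne; have := habove l (by omega) hl hne; linarith [mul_nonneg (Nat.cast_nonneg a) hg0]
      have hrow0 : ∀ h, cornerMidFlow x T j' M ν l h = 0 := by
        intro h
        have := hrow l
        have hle : cornerMidFlow x T j' M ν l h ≤ ∑ h' ∈ Finset.range (M + 1), cornerMidFlow x T j' M ν l h' := by
          by_cases hhM : h ≤ M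
          · exact Finset.single_le_sum (f := fun h' => cornerMidFlow x T j' M ν l h') (fun h' _ => hV0 l h')
              (Finset.mem_range.2 (by omega))
          · have : cornerMidFlow x T j' M ν l h = 0 := by
              by_contra hne; exact hhM (hsup l h hne).2.2.2.1
            rw [this]; exact Finset.sum_nonneg fun h' _ => hV0 l h'
        unfold cornerMidFlow at hle this ⊢
        linarith [hV0 l h]
      have hB0' : ∑ h ∈ Finset.range (M + 1), fB l h = 0 := Finset.sum_eq_zero fun h _ => by
        show lamFlow x T j' M lam ν l h = 0
        unfold lamFlow; rw [hrow0 h]; split_ifs <;> rfl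
      rw [hB0', hz]
      -- leftover_λ(l) = ν l − Σ cornerMidFlow_λ l h = 0 − 0
      unfold cornerLeftover
      obtain ⟨hV0', hsup', hrow', -⟩ := cornerFlow_inv x T lam M ν hx0 hx1 hν ((lam + 1) * (lam + 1)) le_rfl
      have : ∑ h ∈ Finset.range (M + 1), cornerMidFlow x T lam M ν l h = 0 := by
        refine Finset.sum_eq_zero fun h _ => ?_
        by_contra hne
        exact absurd (hsup' l h hne).1 (by omega)
      rw [this, hz]
  have hA : x / (1 - x) * ∑ l ∈ Finset.range (j' + 1), (if 2 * (l : ℝ) < T then νR l else 0)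
      ≤ ∑ h ∈ Finset.Ico (lam + 1) (M + 1), ν h := by
    unfold CornerSucceeds at hCl
    rw [← Finset.sum_filter]
    have e : ∑ l ∈ (Finset.range (j' + 1)).filter (fun l : ℕ => 2 * (l : ℝ) < T), νR l
        = ∑ l ∈ (Finset.range (lam + 1)).filter (fun l : ℕ => 2 * (l : ℝ) < T), cornerLeftover x T lam M ν l := by
      symm
      refine Finset.sum_subset (Finset.filter_subset_filter _ (Finset.range_mono (show lam + 1 ≤ j' + 1 by omega))) ?_ |>.trans ?_
      · intro l hl hnl
        rw [Finset.mem_filter, Finset.mem_range] at hl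
        rw [Finset.mem_filter, Finset.mem_range, not_and] at hnl
        have hlam' : lam < l := by
          by_contra h; exact hnl (by omega) hl.2
        -- leftover of a low above λ vanishes: it is uncharged
        have hz : ν l = 0 := by
          by_contra hne; have := habove l hlam' (by omega) hne; linarith [mul_nonneg (Nat.cast_nonneg a) hg0]
        rw [← hνRlow l (by omega) hl.2]
        exact le_antisymm (by linarith [hνRle l]) (hνR0 l)
      · exact Finset.sum_congr rfl fun l hl => by
          rw [Finset.mem_filter, Finset.mem_range] at hl
          exact (hνRlow l (by omega) hl.2).symm
    rw [e]; exact hCl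
  have hνR_above : ∀ h, lam < h → νR h = ν h := by
    intro h hh
    show ν h - subflowLaw x T j' M fB h = ν h
    unfold subflowLaw
    have h1 : ∑ k ∈ Finset.range (M + 1), fB h k = 0 := by
      refine Finset.sum_eq_zero fun k _ => ?_
      rcases (hB0 h k).eq_or_lt with hz | hp
      · exact hz.symm
      · obtain ⟨-, hl, hlow, -⟩ := lamFlow_pos x T j' M lam ν hx0 hx1 hν h k hp
        exfalso
        have hz : ν h = 0 := by
          by_contra hne; have := habove h hh hl hne; linarith [mul_nonneg (Nat.cast_nonneg a) hg0]
        have := hW.2.2.1 h hl hlow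
        have hle : cornerWitness x T j' M ν h k ≤ ∑ k' ∈ Finset.range (M + 1), cornerWitness x T j' M ν h k' :=
          Finset.single_le_sum (f := fun k' => cornerWitness x T j' M ν h k') (fun k' _ => hW.1 h k')
            (Finset.mem_range.2 (by have := (lamFlow_pos x T j' M lam ν hx0 hx1 hν h k hp).2.2.2.1; omega))
        linarith [hBle h k]
    have h2 : ∑ l ∈ Finset.range (j' + 1), usage x T j' l h * fB l h = 0 := by
      refine Finset.sum_eq_zero fun l _ => ?_
      have : fB l h = 0 := by
        show lamFlow x T j' M lam ν l h = 0
        unfold lamFlow; rw [if_neg (by omega)]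
      rw [this, mul_zero]
    rw [h1, h2]; ring
  have eG : ∑ h ∈ Finset.Ico (lam + 1) (M + 1), νR h = ∑ h ∈ Finset.Ico (lam + 1) (M + 1), ν h :=
    Finset.sum_congr rfl fun h hh => hνR_above h (by rw [Finset.mem_Ico] at hh; omega)
  -- the lows of ν_R = the lows of the zeroed law + the shallow lows
  have e1 : ∑ l ∈ Finset.range (j' + 1), (if 2 * (l : ℝ) < T then νR l else 0)
      = ∑ l ∈ Finset.range (j' + 1), (if 2 * (l : ℝ) < T then νD l else 0)
        + ∑ l ∈ Finset.range (j' + 1), (if l ≤ lam ∧ 2 * (l : ℝ) < T ∧ (T + (a : ℝ) * g ≤ 2 * ((l : ℝ) + a) ∨ j' < l + a) then νR l else 0) := by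
    rw [← Finset.sum_add_distrib]
    refine Finset.sum_congr rfl fun l _ => ?_
    simp only [hνDdef]
    unfold zeroShallow
    by_cases hs : l ≤ lam ∧ 2 * (l : ℝ) < T ∧ (T + (a : ℝ) * g ≤ 2 * ((l : ℝ) + a) ∨ j' < l + a)
    · rw [if_pos hs, if_pos hs, if_pos hs.2.1, if_pos hs.2.1]; ring
    · rw [if_neg hs, if_neg hs, add_zero]
  have eGD : ∑ h ∈ Finset.Ico (lam + 1) (M + 1), νD h = ∑ h ∈ Finset.Ico (lam + 1) (M + 1), ν h := by
    rw [← eG]; exact sum_Ico_zeroShallow T g j' M a lam νR (lam + 1) le_rfl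
  have e : ∑ l ∈ Finset.range (j' + 1), (if 2 * (l : ℝ) < T then dlRest x T g j' a νD fD l else 0)
      = ∑ l ∈ Finset.range (j' + 1), (if 2 * (l : ℝ) < T then νD l else 0)
        - ∑ l ∈ Finset.range (j' + 1), (if 2 * (l : ℝ) < T then ∑ m ∈ Finset.range (j' + 1), dlAd x T g j' a νD fD l m else 0) := by
    rw [← Finset.sum_sub_distrib]
    refine Finset.sum_congr rfl fun l _ => ?_
    unfold dlRest
    split_ifs <;> ring
  rw [e1] at hA
  rw [e]
  unfold dlPoolTot
  rw [eGD]
  set SD := ∑ l ∈ Finset.range (j' + 1), (if 2 * (l : ℝ) < T then νD l else 0)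
  set Ssh := ∑ l ∈ Finset.range (j' + 1), (if l ≤ lam ∧ 2 * (l : ℝ) < T ∧ (T + (a : ℝ) * g ≤ 2 * ((l : ℝ) + a) ∨ j' < l + a) then νR l else 0)
  set F := ∑ l ∈ Finset.range (j' + 1), (if 2 * (l : ℝ) < T then ∑ m ∈ Finset.range (j' + 1), fD l m else 0)
  set D := ∑ l ∈ Finset.range (j' + 1), (if 2 * (l : ℝ) < T then ∑ m ∈ Finset.range (j' + 1), dlAd x T g j' a νD fD l m else 0)
  have hSsh : 0 ≤ Ssh := Finset.sum_nonneg fun l _ => by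
    split_ifs
    · exact hνR0 l
    · exact le_rfl
  have h1 := mul_le_mul_of_nonneg_left hA hg0
  have h2 := mul_le_mul_of_nonneg_left hB (show 0 ≤ 1 - g by linarith)
  have h3 := mul_le_mul_of_nonneg_left hC hu.le
  have h4 : (1 - g) * (x / (1 - x) * Ssh) ≤ g * (x / (1 - x) * Ssh) :=
    mul_le_mul_of_nonneg_right (by linarith) (mul_nonneg hu.le hSsh)
  have hmix : x / (1 - x) * SD = g * (x / (1 - x) * SD) + (1 - g) * (x / (1 - x) * SD) := by ring
  nlinarith

end LamColumns

end LawDec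

end Quant

end Summit.CriticalPhenomena.PercolationContinuityZ3.Theorems
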